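import Mathlib.Analysis.SpecialFunctions.SmoothTransition
import Mathlib.Analysis.Calculus.ContDiff.Deriv
import Mathlib.Analysis.Calculus.Deriv.Prod
import Mathlib.Analysis.Calculus.Deriv.Shift
import Mathlib.Analysis.Calculus.Deriv.Star
import Mathlib.Analysis.Calculus.Deriv.MeanValue
import Mathlib.Analysis.Normed.Ring.Units
import Mathlib.Analysis.Complex.RealDeriv
import Mathlib.Analysis.SpecialFunctions.Sqrt
import Mathlib.Analysis.InnerProductSpace.Calculus
import Mathlib.Topology.Algebra.Module.FiniteDimension
import Literature.Topology.FourManifolds.FramedTubularNbhd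
import HarnessLib

/-!
# Blowing up a plumbing point: the proper transform of a coordinate line, capped, with its tube
# (local model in Kervaire–Milnor connected-sum coordinates)

Topic `Literature/Topology/FourManifolds`; second local model for block 2 of Akhmedov–Park's
`X₁(m)` (A. Akhmedov, B. D. Park, Invent. Math. 181 (2010), §3: "Next, … blow up at the double
point to obtain a smooth genus 2 … surface `Σ̄₂` in `T⁴ # ℂℙ²bar`"), fact seat of the
Seiberg–Witten leaf `Literature.Barriers.SmoothPoincare4.akhmedovPark2010_lemma8_invariants`;
companion of `DoublePointResolutionNeck.lean`.  Everything is PROVED; there are no definitions and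
no named facts (the map is a bare expression bound by a hypothesis `hC : ∀ a ν, C (a, ν) = …`).

## The model

Blowing up a point of a `4`-manifold is the connected sum with `ℂℙ²bar` (McDuff–Salamon,
*Introduction to Symplectic Topology* (2017), Exercise 7.1.4 (ii)); the proper transforms of the
two coordinate lines through the origin of `ℂ²` are disjoint lines (ibid., Example 7.1.9,
"resolving singularities": `V = {z₁ z₂ = 0}` "has a nonsingular lift `Ṽ` consisting of two
disjoint lines").  In the tree's Kervaire–Milnor form of the connected sum
(`Literature.Topology.FourManifolds.ConnectedSumData`: the punctured unit ball `0 < ‖z‖ < 1` of a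
chart at the point is identified with the punctured unit ball of the affine chart of `ℂℙ²` at
`q = [0:0:1]` by `t • u ∼ (1 - t) • u`), the first coordinate line `{(a, 0)}` continues, through
`(a, 0) ∼ [(1 - ‖a‖) â : 0 : 1] = [1 : 0 : conj â / (1 - ‖a‖)]`, into the projective line
`ℓ₁ = {z₁ = 0}` and closes up with the disc `{[1 : 0 : ξ] | ‖ξ‖ ≤ 1}` about `[1 : 0 : 0]`: the
proper transform is the connected sum of the sheet with `ℓ₁`.  This file works in the affine chart
`[1 : w₁ : w₂] ↦ (w₁, w₂)` of `ℂℙ²` at `[1 : 0 : 0]`, where `ℓ₁ = {w₁ = 0}`, and constructs the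
capped proper transform PARAMETRISED BY THE ORIGINAL SHEET COORDINATE `a` (`‖a‖ < 3/4`) together
with a tube:

* core `a ↦ (0, conj â • G ‖a‖)` with a radial stretch `G` (`G ρ = ρ` for `ρ ≤ 1/4`, so the core is
  `a ↦ (0, conj a)` near `a = 0` — smooth, the centre `a = 0` going to `[1 : 0 : 0]`; and
  `G ρ = 1/(1 - ρ)` for `ρ ≥ 1/2`, Kervaire–Milnor's identification, so that from `‖a‖ = 1/2` on the
  core IS the sheet `{(a, 0)}` seen in `ℂℙ²`);
* tube `C (a, ν) = (ν, conj â • H ‖a‖ ‖ν‖²)`, interpolating (by a smooth step `χ` on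
  `1/2 ≤ ‖a‖ ≤ 2/3`) between the product tube `(ν, conj â • G ‖a‖)` of `ℓ₁` near the cap and, for
  `‖a‖ ≥ 2/3`, `(ν, conj â • s/(1 - ‖a‖ s))`, `s = √(1 + ‖ν‖²)` — which is the Kervaire–Milnor
  image of the product tube `(a, a ν)` of the sheet (the identity
  `(a, a ν) ∼ [1 : ν : conj â • s/(1 - ‖a‖ s)]` is the content of the companion gluing file): along
  the sheet the framing has turned once POSITIVELY (`a ν = ‖a‖ • â • ν`), the `-1` of the blown-up
  surface's normal Euler number.

## Results

* `exists_blowUpCapTube` — **the capped proper transform with its tube exists**: a map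
  `C : ℂ × ℂ → ℂ × ℂ`, `C∞` on `U = {‖a‖ < 3/4} × {‖ν‖ < 1/2}`, equal to `(ν, conj a)` for
  `‖a‖ ≤ 1/4` and to `(ν, conj â • s/(1 - ‖a‖ s))` for `2/3 ≤ ‖a‖`, with core
  `C (a, 0) = (0, conj â/(1 - ‖a‖))` for `1/2 ≤ ‖a‖`, first component always `ν`, injective on `U`
  with an invertible strict derivative at every point of `U`, and with the norm of the second
  component strictly increasing in `‖a‖` (so that cap points stay below the values
  `s/(1 - ‖a‖ s)`, `‖a‖ ≥ 2/3`, of the sheet's tube further out).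
* Ingredients for any stretch/step `(k₀, χ)` (hypotheses `hk…`, `hχ…`; `G ρ = ρ k₀ ρ`): the radial
  profile `H` and its strict monotonicity (`strictMonoOn_capProfile`, from
  `strictMonoOn_of_deriv_pos`: `∂H/∂ρ = (1 - χ) G′ + χ s²/(1 - ρ s)² + χ′ (F - G) > 0` since `χ′ ≥ 0`
  and `F = s/(1 - ρ s) ≥ 1/(1 - ρ) = G` on the transition), smoothness (`contDiffAt_cap`),
  injectivity (`injOn_cap`), the derivative along the radial and rotation curves and the
  invertibility (`exists_hasStrictFDerivAt_cap`), by the same elementary calculus as in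
  `DoublePointResolutionNeck.lean` (kept independent of that file).

## References

* D. McDuff, D. Salamon, *Introduction to Symplectic Topology*, 3rd ed. (2017), Exercise 7.1.4 (ii)
  (blow-up `= M # ℂℙⁿbar`) and Example 7.1.9 (proper transforms of `{z₁ z₂ = 0}`). [McDuffSalamon2017]
* M. Kervaire, J. Milnor, *Groups of homotopy spheres I*, Ann. of Math. 77 (1963), §2.
  [KervaireMilnor1963]
* A. Akhmedov, B. D. Park, Invent. Math. 181 (2010) 577–603 = arXiv:math/0701829, §3.
  [AkhmedovPark2010]
-/

noncomputable section

open scoped Topology ContDiff ComplexConjugate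
open Set Function Filter Metric Complex

namespace Literature.Topology.FourManifolds

namespace BlowUpCap

/-! ### §0 Local helpers: unit vectors and invertible strict derivatives on `ℂ × ℂ` -/

section Helpers

/-- Unit-vector algebra for `û = v/‖v‖`, `v ≠ 0`: `‖û‖ = 1`, `û ≠ 0`, `‖v‖ û = v`,
`û conj û = 1`. [folklore] -/
theorem unitVec_basic {v : ℂ} (hv : v ≠ 0) :
    ‖((‖v‖⁻¹ : ℝ) : ℂ) * v‖ = 1 ∧ ((‖v‖⁻¹ : ℝ) : ℂ) * v ≠ 0 ∧
      ((‖v‖ : ℝ) : ℂ) * (((‖v‖⁻¹ : ℝ) : ℂ) * v) = v ∧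
      (((‖v‖⁻¹ : ℝ) : ℂ) * v) * conj (((‖v‖⁻¹ : ℝ) : ℂ) * v) = 1 := by
  have h1 : ‖((‖v‖⁻¹ : ℝ) : ℂ) * v‖ = 1 := by
    rw [norm_mul, Complex.norm_real, norm_inv, norm_norm, inv_mul_cancel₀ (norm_ne_zero_iff.2 hv)]
  refine ⟨h1, ?_, ?_, ?_⟩
  · rw [← norm_ne_zero_iff, h1]; exact one_ne_zero
  · rw [← mul_assoc, ← Complex.ofReal_mul, mul_inv_cancel₀ (norm_ne_zero_iff.2 hv),
      Complex.ofReal_one, one_mul]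
  · rw [Complex.mul_conj, Complex.normSq_eq_norm_sq, h1]; norm_num

/-- Unit vectors of positive rescalings and of rotations of `v ≠ 0`: `(r û)^ = û` (`r > 0`) and
`(e^{is} v)^ = e^{is} û`. [folklore] -/
theorem unitVec_rescale {v : ℂ} (hv : v ≠ 0) {r : ℝ} (hr : 0 < r) (s : ℝ) :
    ((‖(r : ℂ) * (((‖v‖⁻¹ : ℝ) : ℂ) * v)‖⁻¹ : ℝ) : ℂ) * ((r : ℂ) * (((‖v‖⁻¹ : ℝ) : ℂ) * v)) =
      ((‖v‖⁻¹ : ℝ) : ℂ) * v ∧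
    ((‖Complex.exp (s * I) * v‖⁻¹ : ℝ) : ℂ) * (Complex.exp (s * I) * v) =
      Complex.exp (s * I) * (((‖v‖⁻¹ : ℝ) : ℂ) * v) := by
  constructor
  · have hn : ‖(r : ℂ) * (((‖v‖⁻¹ : ℝ) : ℂ) * v)‖ = r := by
      rw [norm_mul, (unitVec_basic hv).1, mul_one, Complex.norm_real, Real.norm_of_nonneg hr.le]
    rw [hn, ← mul_assoc, ← Complex.ofReal_mul, inv_mul_cancel₀ hr.ne', Complex.ofReal_one, one_mul]
  · rw [norm_mul, Complex.norm_exp_ofReal_mul_I, one_mul]; ring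

/-- A `C^∞` self-map of `ℂ × ℂ` with a differentiable local left inverse has an invertible strict
derivative. [folklore] -/
theorem exists_equiv_of_leftInverse {f g : ℂ × ℂ → ℂ × ℂ} {p : ℂ × ℂ} (hf : ContDiffAt ℝ ∞ f p)
    (hg : DifferentiableAt ℝ g (f p)) (h : ∀ᶠ q in 𝓝 p, g (f q) = q) :
    ∃ L : (ℂ × ℂ) ≃L[ℝ] (ℂ × ℂ), HasStrictFDerivAt f (L : ℂ × ℂ →L[ℝ] ℂ × ℂ) p := by
  have hf' : HasStrictFDerivAt f (fderiv ℝ f p) p := hf.hasStrictFDerivAt (by simp)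
  have hcomp : HasFDerivAt (g ∘ f) ((fderiv ℝ g (f p)).comp (fderiv ℝ f p)) p :=
    hg.hasFDerivAt.comp p hf'.hasFDerivAt
  have hid : HasFDerivAt (g ∘ f) (ContinuousLinearMap.id ℝ (ℂ × ℂ)) p :=
    (hasFDerivAt_id p).congr_of_eventuallyEq (h.mono fun q hq => hq)
  have heq : (fderiv ℝ g (f p)).comp (fderiv ℝ f p) = ContinuousLinearMap.id ℝ (ℂ × ℂ) :=
    hcomp.unique hid
  have hinj : Injective (fderiv ℝ f p) := by
    intro x y hxy
    have := congrArg (fderiv ℝ g (f p)) hxy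
    rwa [← ContinuousLinearMap.comp_apply, ← ContinuousLinearMap.comp_apply, heq,
      ContinuousLinearMap.id_apply, ContinuousLinearMap.id_apply] at this
  have hbij : Bijective (fderiv ℝ f p) :=
    ⟨hinj, LinearMap.surjective_of_injective (f := (fderiv ℝ f p).toLinearMap) hinj⟩
  let L : (ℂ × ℂ) ≃L[ℝ] (ℂ × ℂ) :=
    (LinearEquiv.ofBijective (fderiv ℝ f p).toLinearMap hbij).toContinuousLinearEquiv
  refine ⟨L, ?_⟩
  have hL : (L : ℂ × ℂ →L[ℝ] ℂ × ℂ) = fderiv ℝ f p := ContinuousLinearMap.ext fun x => rfl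
  rw [hL]
  exact hf'

end Helpers

/-! ### §1 The stretch `G ρ = ρ k₀ ρ`, the step `χ`, the far profile `F`, the cap profile `H` -/

section Profile

variable {k₀ χ : ℝ → ℝ}

variable (hks : ∀ ρ, ρ < 1 → ContDiffAt ℝ ∞ k₀ ρ) (hk0 : ∀ ρ, ρ ≤ 1 / 4 → k₀ ρ = 1)
  (hk1 : ∀ ρ, 1 / 2 ≤ ρ → ρ < 1 → k₀ ρ = (ρ * (1 - ρ))⁻¹)
  (hkpos : ∀ ρ, 0 ≤ ρ → ρ < 1 → 0 < k₀ ρ)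
  (hkd : ∀ ρ, 0 < ρ → ρ < 1 → 0 < deriv (fun r => r * k₀ r) ρ)
  (hχs : ContDiff ℝ ∞ χ) (hχ0 : ∀ ρ, ρ ≤ 1 / 2 → χ ρ = 0) (hχ1 : ∀ ρ, 2 / 3 ≤ ρ → χ ρ = 1)
  (hχm : Monotone χ) (hχb : ∀ ρ, 0 ≤ χ ρ ∧ χ ρ ≤ 1)

/-- `s = √(1 + q) ≥ 1`. [folklore] -/
theorem one_le_sqrt_one_add {q : ℝ} (hq : 0 ≤ q) : 1 ≤ Real.sqrt (1 + q) :=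
  calc (1 : ℝ) = Real.sqrt 1 := Real.sqrt_one.symm
    _ ≤ Real.sqrt (1 + q) := Real.sqrt_le_sqrt (by linarith)

/-- For `q < 1/4`, `s = √(1 + q) < 6/5`. [folklore] -/
theorem sqrt_one_add_lt {q : ℝ} (hq : q < 1 / 4) : Real.sqrt (1 + q) < 6 / 5 :=
  (Real.sqrt_lt' (by norm_num)).2 (by nlinarith)

/-- On the working domain `ρ < 4/5`, `q < 1/4` the denominator `1 - ρ s` stays above `1/25`.
[folklore] -/
theorem one_sub_mul_sqrt_pos {ρ q : ℝ} (hρ : ρ < 4 / 5) (hq0 : 0 ≤ q) (hq : q < 1 / 4) :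
    1 / 25 < 1 - ρ * Real.sqrt (1 + q) := by
  have hs := sqrt_one_add_lt hq
  have hs1 := one_le_sqrt_one_add hq0
  nlinarith

include hk0 in
/-- The stretch is the identity near `0`: `G ρ = ρ` for `ρ ≤ 1/4`. [folklore] -/
theorem stretch_eq_self {ρ : ℝ} (hρ : ρ ≤ 1 / 4) : ρ * k₀ ρ = ρ := by rw [hk0 ρ hρ, mul_one]

include hk1 in
/-- The stretch is Kervaire–Milnor's `1/(1 - ρ)` from `1/2` on. [cite: KervaireMilnor1963, §2] -/
theorem stretch_eq_inv {ρ : ℝ} (hρ : 1 / 2 ≤ ρ) (hρ1 : ρ < 1) : ρ * k₀ ρ = (1 - ρ)⁻¹ := by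
  rw [hk1 ρ hρ hρ1, mul_inv, ← mul_assoc, mul_inv_cancel₀ (by linarith : ρ ≠ 0), one_mul]

include hkpos in
/-- `G ρ > 0` for `0 < ρ < 1`. [folklore] -/
theorem stretch_pos {ρ : ℝ} (hρ : 0 < ρ) (hρ1 : ρ < 1) : 0 < ρ * k₀ ρ :=
  mul_pos hρ (hkpos ρ hρ.le hρ1)

/-- The far profile `F ρ q = s/(1 - ρ s)` is at least `1/(1 - ρ)` (`s ≥ 1`). [folklore] -/
theorem inv_one_sub_le_farProfile {ρ q : ℝ} (hρ : ρ < 4 / 5) (hq0 : 0 ≤ q) (hq : q < 1 / 4) :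
    (1 - ρ)⁻¹ ≤ Real.sqrt (1 + q) / (1 - ρ * Real.sqrt (1 + q)) := by
  have hd := one_sub_mul_sqrt_pos hρ hq0 hq
  have hs1 := one_le_sqrt_one_add hq0
  rw [inv_eq_one_div, div_le_div_iff₀ (by linarith) (by linarith)]
  nlinarith

/-- The far profile is positive on the working domain. [folklore] -/
theorem farProfile_pos {ρ q : ℝ} (hρ : ρ < 4 / 5) (hq0 : 0 ≤ q) (hq : q < 1 / 4) :
    0 < Real.sqrt (1 + q) / (1 - ρ * Real.sqrt (1 + q)) :=
  div_pos (lt_of_lt_of_le one_pos (one_le_sqrt_one_add hq0))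
    (lt_trans (by norm_num) (one_sub_mul_sqrt_pos hρ hq0 hq))

/-- The `ρ`-derivative of the far profile: `∂F/∂ρ = s²/(1 - ρ s)²`. [folklore] -/
theorem hasDerivAt_farProfile {ρ q : ℝ} (hρ : ρ < 4 / 5) (hq0 : 0 ≤ q) (hq : q < 1 / 4) :
    HasDerivAt (fun r => Real.sqrt (1 + q) / (1 - r * Real.sqrt (1 + q)))
      (Real.sqrt (1 + q) ^ 2 / (1 - ρ * Real.sqrt (1 + q)) ^ 2) ρ := by
  have hd := one_sub_mul_sqrt_pos hρ hq0 hq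
  have h1 : HasDerivAt (fun r => 1 - r * Real.sqrt (1 + q)) (-Real.sqrt (1 + q)) ρ := by
    simpa using ((hasDerivAt_id ρ).mul_const (Real.sqrt (1 + q))).const_sub 1
  exact ((hasDerivAt_const ρ (Real.sqrt (1 + q))).div h1 (by linarith)).congr_deriv (by ring)

include hχ0 in
/-- `χ′ = 0` on `ρ < 1/2`. [folklore] -/
theorem deriv_step_eq_zero_of_lt {ρ : ℝ} (hρ : ρ < 1 / 2) : deriv χ ρ = 0 := by
  have h : χ =ᶠ[𝓝 ρ] fun _ => (0 : ℝ) :=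
    eventuallyEq_of_mem (Iio_mem_nhds hρ) fun s hs => hχ0 s (le_of_lt hs)
  rw [h.deriv_eq]
  exact deriv_const ρ 0

include hks hk1 hkd hχs hχ0 hχm hχb in
/-- **The cap profile `H(·, q) = (1 - χ) G + χ F` has positive `ρ`-derivative on `(0, 4/5)`** for
every `0 ≤ q < 1/4`: the derivative is `(1 - χ) G′ + χ ∂F/∂ρ + χ′ (F - G)` with `G′ > 0`,
`∂F/∂ρ = s²/(1 - ρ s)² > 0`, `χ′ ≥ 0` (the step is monotone) and `F ≥ G` where `χ′ ≠ 0`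
(`1/2 ≤ ρ`, where `G = 1/(1 - ρ) ≤ s/(1 - ρ s)` as `s ≥ 1`). [folklore] -/
theorem exists_hasDerivAt_capProfile_pos {q : ℝ} (hq0 : 0 ≤ q) (hq : q < 1 / 4) {ρ : ℝ} (hρ0 : 0 < ρ)
    (hρ : ρ < 4 / 5) : ∃ d : ℝ, 0 < d ∧
    HasDerivAt (fun ρ => (1 - χ ρ) * (ρ * k₀ ρ) +
      χ ρ * (Real.sqrt (1 + q) / (1 - ρ * Real.sqrt (1 + q)))) d ρ := by
  set s : ℝ := Real.sqrt (1 + q) with hs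
  have hGd : HasDerivAt (fun r => r * k₀ r) (deriv (fun r => r * k₀ r) ρ) ρ :=
    ((contDiffAt_id.mul (hks ρ (by linarith))).differentiableAt (by simp)).hasDerivAt
  have hχd : HasDerivAt χ (deriv χ ρ) ρ := ((hχs.differentiable (by simp)) ρ).hasDerivAt
  have hF := hasDerivAt_farProfile hρ hq0 hq
  have h1 : HasDerivAt (fun r => 1 - χ r) (-deriv χ ρ) ρ := by simpa using hχd.const_sub 1
  refine ⟨_, ?_, (h1.mul hGd).add (hχd.mul hF)⟩
  have hχ' : 0 ≤ deriv χ ρ := hχm.deriv_nonneg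
  have hG' : 0 < deriv (fun r => r * k₀ r) ρ := hkd ρ hρ0 (by linarith)
  have hF' : 0 < s ^ 2 / (1 - ρ * s) ^ 2 := by
    have := one_sub_mul_sqrt_pos hρ hq0 hq
    have := one_le_sqrt_one_add hq0
    positivity
  obtain ⟨hχ0', hχ1'⟩ := hχb ρ
  -- the term `χ′ (F - G)` is nonnegative: either `χ′ = 0` or `G = 1/(1 - ρ) ≤ F`
  have hcross : 0 ≤ deriv χ ρ * (s / (1 - ρ * s)) - deriv χ ρ * (ρ * k₀ ρ) := by
    rcases lt_or_ge ρ (1 / 2) with h | h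
    · rw [deriv_step_eq_zero_of_lt hχ0 h]; simp
    · rw [stretch_eq_inv hk1 h (by linarith), ← mul_sub]
      exact mul_nonneg hχ' (by linarith [inv_one_sub_le_farProfile hρ hq0 hq])
  -- the main term `(1 - χ) G′ + χ F′` is positive
  have hmain : 0 < (1 - χ ρ) * deriv (fun r => r * k₀ r) ρ + χ ρ * (s ^ 2 / (1 - ρ * s) ^ 2) := by
    rcases lt_or_ge (χ ρ) 1 with h | h
    · have : 0 < (1 - χ ρ) * deriv (fun r => r * k₀ r) ρ := mul_pos (by linarith) hG'
      nlinarith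
    · have hχe : χ ρ = 1 := le_antisymm hχ1' h
      rw [hχe]; simpa using hF'
  nlinarith

include hks hχs in
/-- The cap profile is continuous at every `ρ < 4/5` (for `0 ≤ q < 1/4`). [folklore] -/
theorem continuousAt_capProfile {q : ℝ} (hq0 : 0 ≤ q) (hq : q < 1 / 4) {ρ : ℝ} (hρ : ρ < 4 / 5) :
    ContinuousAt (fun ρ => (1 - χ ρ) * (ρ * k₀ ρ) +
      χ ρ * (Real.sqrt (1 + q) / (1 - ρ * Real.sqrt (1 + q)))) ρ := by
  have hd := one_sub_mul_sqrt_pos hρ hq0 hq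
  have hk : ContinuousAt k₀ ρ := (hks ρ (by linarith)).continuousAt
  have hχc : ContinuousAt χ ρ := hχs.continuous.continuousAt
  refine ((continuousAt_const.sub hχc).mul (continuousAt_id.mul hk)).add (hχc.mul ?_)
  exact continuousAt_const.div (continuousAt_const.sub (continuousAt_id.mul continuousAt_const))
    (by linarith)

include hks hk1 hkd hχs hχ0 hχm hχb in
/-- **The cap profile is strictly increasing on `[0, 3/4]`** (positive derivative inside,
continuity up to the ends). [folklore] -/
theorem strictMonoOn_capProfile {q : ℝ} (hq0 : 0 ≤ q) (hq : q < 1 / 4) :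
    StrictMonoOn (fun ρ => (1 - χ ρ) * (ρ * k₀ ρ) +
      χ ρ * (Real.sqrt (1 + q) / (1 - ρ * Real.sqrt (1 + q)))) (Icc 0 (3 / 4)) := by
  refine strictMonoOn_of_deriv_pos (convex_Icc 0 (3 / 4))
    (fun ρ hρ => (continuousAt_capProfile hks hχs hq0 hq (by linarith [hρ.2])).continuousWithinAt)
    fun ρ hρ => ?_
  rw [interior_Icc] at hρ
  obtain ⟨d, hd, hD⟩ := exists_hasDerivAt_capProfile_pos hks hk1 hkd hχs hχ0 hχm hχb hq0 hq hρ.1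
    (by linarith [hρ.2])
  rwa [hD.deriv]

include hkpos hχb in
/-- The cap profile is positive for `0 < ρ < 4/5` and vanishes at `ρ = 0`. [folklore] -/
theorem capProfile_pos {q : ℝ} (hq0 : 0 ≤ q) (hq : q < 1 / 4) {ρ : ℝ} (hρ0 : 0 < ρ) (hρ : ρ < 4 / 5) :
    0 < (1 - χ ρ) * (ρ * k₀ ρ) + χ ρ * (Real.sqrt (1 + q) / (1 - ρ * Real.sqrt (1 + q))) := by
  have hG := stretch_pos hkpos hρ0 (by linarith)
  have hF := farProfile_pos hρ hq0 hq
  obtain ⟨h0, h1⟩ := hχb ρ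
  rcases lt_or_ge (χ ρ) 1 with h | h
  · nlinarith [mul_pos (by linarith : 0 < 1 - χ ρ) hG, mul_nonneg h0 hF.le]
  · have : χ ρ = 1 := le_antisymm h1 h
    rw [this]; simpa using hF

include hχ0 in
/-- The cap profile vanishes at `ρ = 0`. [folklore] -/
theorem capProfile_zero (q : ℝ) :
    (1 - χ 0) * (0 * k₀ 0) + χ 0 * (Real.sqrt (1 + q) / (1 - 0 * Real.sqrt (1 + q))) = 0 := by
  rw [hχ0 0 (by norm_num)]; ring

/-- The far profile is increasing in `ρ` (the denominator decreases). [folklore] -/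
theorem farProfile_le_farProfile {ρ ρ' q : ℝ} (hρρ' : ρ ≤ ρ') (hρ' : ρ' < 4 / 5) (hq0 : 0 ≤ q)
    (hq : q < 1 / 4) :
    Real.sqrt (1 + q) / (1 - ρ * Real.sqrt (1 + q)) ≤ Real.sqrt (1 + q) / (1 - ρ' * Real.sqrt (1 + q)) := by
  have hd' := one_sub_mul_sqrt_pos hρ' hq0 hq
  have hs1 := one_le_sqrt_one_add hq0
  exact div_le_div_of_nonneg_left (by linarith) (by linarith) (by nlinarith)

end Profile

/-! ### §2 The cap map, its smoothness and its explicit forms -/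

section Cap

variable {k₀ χ : ℝ → ℝ} {C : ℂ × ℂ → ℂ × ℂ}

variable (hks : ∀ ρ, ρ < 1 → ContDiffAt ℝ ∞ k₀ ρ) (hk0 : ∀ ρ, ρ ≤ 1 / 4 → k₀ ρ = 1)
  (hk1 : ∀ ρ, 1 / 2 ≤ ρ → ρ < 1 → k₀ ρ = (ρ * (1 - ρ))⁻¹)
  (hkpos : ∀ ρ, 0 ≤ ρ → ρ < 1 → 0 < k₀ ρ)
  (hkd : ∀ ρ, 0 < ρ → ρ < 1 → 0 < deriv (fun r => r * k₀ r) ρ)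
  (hχs : ContDiff ℝ ∞ χ) (hχ0 : ∀ ρ, ρ ≤ 1 / 2 → χ ρ = 0) (hχ1 : ∀ ρ, 2 / 3 ≤ ρ → χ ρ = 1)
  (hχm : Monotone χ) (hχb : ∀ ρ, 0 ≤ χ ρ ∧ χ ρ ≤ 1)
  (hC : ∀ a ν, C (a, ν) = (ν, conj a *
    (((1 - χ ‖a‖) * k₀ ‖a‖ + χ ‖a‖ * (Real.sqrt (1 + ‖ν‖ ^ 2) / (1 - ‖a‖ * Real.sqrt (1 + ‖ν‖ ^ 2)) / ‖a‖) : ℝ) : ℂ)))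

include hC in
/-- The cap map as a function of the pair. [folklore] -/
theorem cap_eq_fun : C = fun p : ℂ × ℂ => (p.2, conj p.1 *
    (((1 - χ ‖p.1‖) * k₀ ‖p.1‖ + χ ‖p.1‖ *
      (Real.sqrt (1 + ‖p.2‖ ^ 2) / (1 - ‖p.1‖ * Real.sqrt (1 + ‖p.2‖ ^ 2)) / ‖p.1‖) : ℝ) : ℂ)) :=
  funext fun ⟨a, ν⟩ => hC a ν

include hC in
/-- The first component of the cap map is the fibre coordinate `ν`. [folklore] -/
theorem cap_fst (a ν : ℂ) : (C (a, ν)).1 = ν := by rw [hC]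

/-- `‖ν‖ < 1/2` gives `q = ‖ν‖² < 1/4`. [folklore] -/
theorem norm_sq_lt_of_norm_lt {ν : ℂ} (hν : ‖ν‖ < 1 / 2) : ‖ν‖ ^ 2 < 1 / 4 := by
  nlinarith [norm_nonneg ν]

include hk0 hχ0 hC in
/-- **Near the cap centre**, `‖a‖ ≤ 1/4`: `C (a, ν) = (ν, conj a)` — the product tube of the line
`ℓ₁ = {w₁ = 0}` at its point `(0, conj a)`; in particular the centre `a = 0` is no special point.
[cite: McDuffSalamon2017, Example 7.1.9] -/
theorem cap_eq_of_le {a : ℂ} (ha : ‖a‖ ≤ 1 / 4) (ν : ℂ) : C (a, ν) = (ν, conj a) := by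
  rw [hC, hχ0 _ (by linarith), hk0 _ ha]
  simp

include hχ1 hC in
/-- **On the far zone**, `2/3 ≤ ‖a‖`: `C (a, ν) = (ν, conj â • s/(1 - ‖a‖ s))`, `s = √(1 + ‖ν‖²)`,
the Kervaire–Milnor image of the sheet's product tube `(a, a ν)`. [cite: KervaireMilnor1963, §2] -/
theorem cap_eq_of_ge {a : ℂ} (ha : 2 / 3 ≤ ‖a‖) (ν : ℂ) :
    C (a, ν) = (ν, conj (((‖a‖⁻¹ : ℝ) : ℂ) * a) *
      (Real.sqrt (1 + ‖ν‖ ^ 2) / (1 - ‖a‖ * Real.sqrt (1 + ‖ν‖ ^ 2)) : ℝ)) := by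
  have ha0 : ‖a‖ ≠ 0 := by linarith
  have key : (1 - χ ‖a‖) * k₀ ‖a‖ + χ ‖a‖ *
      (Real.sqrt (1 + ‖ν‖ ^ 2) / (1 - ‖a‖ * Real.sqrt (1 + ‖ν‖ ^ 2)) / ‖a‖) =
      ‖a‖⁻¹ * (Real.sqrt (1 + ‖ν‖ ^ 2) / (1 - ‖a‖ * Real.sqrt (1 + ‖ν‖ ^ 2))) := by
    rw [hχ1 _ ha, sub_self, zero_mul, zero_add, one_mul, div_eq_inv_mul]
  rw [hC, key, Complex.ofReal_mul, map_mul, Complex.conj_ofReal]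
  refine Prod.ext rfl ?_
  simp only
  ring

include hC in
/-- The second component of the cap map at `a ≠ 0` is `conj â` times the cap profile
`H ‖a‖ ‖ν‖²`. [folklore] -/
theorem cap_snd_eq {a : ℂ} (ha : a ≠ 0) (ν : ℂ) :
    (C (a, ν)).2 = conj (((‖a‖⁻¹ : ℝ) : ℂ) * a) *
      (((1 - χ ‖a‖) * (‖a‖ * k₀ ‖a‖) + χ ‖a‖ *
        (Real.sqrt (1 + ‖ν‖ ^ 2) / (1 - ‖a‖ * Real.sqrt (1 + ‖ν‖ ^ 2))) : ℝ) : ℂ) := by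
  have ha0 : ‖a‖ ≠ 0 := norm_ne_zero_iff.2 ha
  have key : (1 - χ ‖a‖) * k₀ ‖a‖ + χ ‖a‖ *
      (Real.sqrt (1 + ‖ν‖ ^ 2) / (1 - ‖a‖ * Real.sqrt (1 + ‖ν‖ ^ 2)) / ‖a‖) =
      ‖a‖⁻¹ * ((1 - χ ‖a‖) * (‖a‖ * k₀ ‖a‖) + χ ‖a‖ *
        (Real.sqrt (1 + ‖ν‖ ^ 2) / (1 - ‖a‖ * Real.sqrt (1 + ‖ν‖ ^ 2)))) := by
    generalize Real.sqrt (1 + ‖ν‖ ^ 2) / (1 - ‖a‖ * Real.sqrt (1 + ‖ν‖ ^ 2)) = F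
    field_simp
  rw [hC, key, Complex.ofReal_mul, map_mul, Complex.conj_ofReal]
  simp only
  ring

include hk1 hC in
/-- **The core on `1/2 ≤ ‖a‖ < 1` is the sheet seen in `ℂℙ²`**: `C (a, 0) = (0, conj â/(1 - ‖a‖))`,
the point `[1 : 0 : conj â/(1 - ‖a‖)] = [(1 - ‖a‖) â : 0 : 1] ∼ (a, 0)`. [cite: KervaireMilnor1963, §2] -/
theorem cap_core_of_ge {a : ℂ} (ha : 1 / 2 ≤ ‖a‖) (ha1 : ‖a‖ < 1) :
    C (a, 0) = (0, conj (((‖a‖⁻¹ : ℝ) : ℂ) * a) * (((1 - ‖a‖)⁻¹ : ℝ) : ℂ)) := by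
  have ha0 : a ≠ 0 := by rw [← norm_pos_iff]; linarith
  refine Prod.ext (by rw [cap_fst hC]) ?_
  rw [cap_snd_eq hC ha0]
  congr 2
  rw [norm_zero, zero_pow two_ne_zero, add_zero, Real.sqrt_one, mul_one, ← stretch_eq_inv hk1 ha ha1,
    one_div]
  rw [stretch_eq_inv hk1 ha ha1]
  ring

include hkpos hχ0 hχb hC in
/-- **The norm of the second component is the cap profile** `H ‖a‖ ‖ν‖²` (on the working domain).
[folklore] -/
theorem norm_cap_snd {a ν : ℂ} (ha : ‖a‖ < 4 / 5) (hν : ‖ν‖ < 1 / 2) :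
    ‖(C (a, ν)).2‖ = (1 - χ ‖a‖) * (‖a‖ * k₀ ‖a‖) + χ ‖a‖ *
      (Real.sqrt (1 + ‖ν‖ ^ 2) / (1 - ‖a‖ * Real.sqrt (1 + ‖ν‖ ^ 2))) := by
  rcases eq_or_ne a 0 with rfl | ha0
  · rw [hC]
    simp [hχ0 0 (by norm_num)]
  · rw [cap_snd_eq hC ha0, norm_mul, Complex.norm_conj, (unitVec_basic ha0).1, one_mul, Complex.norm_real,
      Real.norm_of_nonneg]
    exact (capProfile_pos hkpos hχb (sq_nonneg _) (norm_sq_lt_of_norm_lt hν) (norm_pos_iff.2 ha0)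
      ha).le

include hk0 hχ0 hC in
/-- Near the centre (`‖a‖ < 1/4`) the cap map is `C^∞` (it is `(ν, conj a)` there). [folklore] -/
theorem contDiffAt_cap_of_lt {a : ℂ} (ha : ‖a‖ < 1 / 4) (ν : ℂ) : ContDiffAt ℝ ∞ C (a, ν) := by
  have hmem : {p : ℂ × ℂ | ‖p.1‖ < 1 / 4} ∈ 𝓝 (a, ν) :=
    (isOpen_lt (continuous_norm.comp continuous_fst) continuous_const).mem_nhds ha
  have heq : C =ᶠ[𝓝 (a, ν)] fun p => (p.2, conj p.1) := by
    refine eventuallyEq_of_mem hmem ?_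
    rintro ⟨b, μ⟩ hb
    exact cap_eq_of_le hk0 hχ0 hC (le_of_lt hb) μ
  exact (contDiffAt_snd.prodMk (Complex.conjCLE.contDiff.contDiffAt.comp _ contDiffAt_fst)).congr_of_eventuallyEq heq

include hks hk0 hχs hχ0 hC in
/-- **The cap map is `C^∞` on `{‖a‖ < 3/4} × {‖ν‖ < 1/2}`**: near the centre it is `(ν, conj a)`,
elsewhere a composite of smooth functions (`‖a‖ ≠ 0`, `1 - ‖a‖ s ≠ 0`). [folklore] -/
theorem contDiffAt_cap {a ν : ℂ} (ha : ‖a‖ < 3 / 4) (hν : ‖ν‖ < 1 / 2) : ContDiffAt ℝ ∞ C (a, ν) := by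
  rcases lt_or_ge ‖a‖ (1 / 4) with ha4 | ha4
  · exact contDiffAt_cap_of_lt hk0 hχ0 hC ha4 ν
  · -- away from the centre: the composite formula
    have ha0 : a ≠ 0 := by rw [← norm_pos_iff]; linarith
    rw [cap_eq_fun hC]
    have hT : ContDiffAt ℝ ∞ (fun p : ℂ × ℂ => ‖p.1‖) (a, ν) :=
      (contDiffAt_norm ℝ ha0).comp (a, ν) contDiffAt_fst
    have hQ : ContDiffAt ℝ ∞ (fun p : ℂ × ℂ => ‖p.2‖ ^ 2) (a, ν) :=
      (contDiff_norm_sq ℝ).contDiffAt.comp (a, ν) contDiffAt_snd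
    have hS : ContDiffAt ℝ ∞ (fun p : ℂ × ℂ => Real.sqrt (1 + ‖p.2‖ ^ 2)) (a, ν) :=
      (Real.contDiffAt_sqrt (by positivity)).comp (a, ν) (contDiffAt_const.add hQ)
    have hk : ContDiffAt ℝ ∞ (fun p : ℂ × ℂ => k₀ ‖p.1‖) (a, ν) := (hks _ (by linarith)).comp (a, ν) hT
    have hχ : ContDiffAt ℝ ∞ (fun p : ℂ × ℂ => χ ‖p.1‖) (a, ν) := hχs.contDiffAt.comp (a, ν) hT
    have hd : 1 - ‖a‖ * Real.sqrt (1 + ‖ν‖ ^ 2) ≠ 0 :=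
      (lt_trans (by norm_num) (one_sub_mul_sqrt_pos (by linarith) (sq_nonneg _)
        (norm_sq_lt_of_norm_lt hν))).ne'
    have hF : ContDiffAt ℝ ∞ (fun p : ℂ × ℂ =>
        Real.sqrt (1 + ‖p.2‖ ^ 2) / (1 - ‖p.1‖ * Real.sqrt (1 + ‖p.2‖ ^ 2))) (a, ν) :=
      hS.div (contDiffAt_const.sub (hT.mul hS)) hd
    have hbr : ContDiffAt ℝ ∞ (fun p : ℂ × ℂ => (1 - χ ‖p.1‖) * k₀ ‖p.1‖ + χ ‖p.1‖ *
        (Real.sqrt (1 + ‖p.2‖ ^ 2) / (1 - ‖p.1‖ * Real.sqrt (1 + ‖p.2‖ ^ 2)) / ‖p.1‖)) (a, ν) :=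
      ((contDiffAt_const.sub hχ).mul hk).add (hχ.mul (hF.div hT (norm_ne_zero_iff.2 ha0)))
    exact contDiffAt_snd.prodMk ((Complex.conjCLE.contDiff.contDiffAt.comp _ contDiffAt_fst).mul
      (Complex.ofRealCLM.contDiff.contDiffAt.comp (a, ν) hbr))

/-! ### §3 Injectivity of the cap map -/

include hks hk1 hkpos hkd hχs hχ0 hχm hχb hC in
/-- **The cap map is injective on `{‖a‖ < 3/4} × {‖ν‖ < 1/2}`**: the first component gives `ν`,
the norm of the second gives `‖a‖` by strict monotonicity of the cap profile, and its direction
gives `â`. [folklore] -/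
theorem injOn_cap : InjOn C {p : ℂ × ℂ | ‖p.1‖ < 3 / 4 ∧ ‖p.2‖ < 1 / 2} := by
  rintro ⟨a, ν⟩ ⟨ha, hν⟩ ⟨a', ν'⟩ ⟨ha', hν'⟩ h
  simp only at ha hν ha' hν'
  have h1 : ν = ν' := by rw [← cap_fst hC a ν, ← cap_fst hC a' ν', h]
  subst h1
  have hq0 : 0 ≤ ‖ν‖ ^ 2 := sq_nonneg _
  have hq : ‖ν‖ ^ 2 < 1 / 4 := norm_sq_lt_of_norm_lt hν
  have hn : ‖(C (a, ν)).2‖ = ‖(C (a', ν)).2‖ := by rw [h]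
  rw [norm_cap_snd hkpos hχ0 hχb hC (by linarith) hν, norm_cap_snd hkpos hχ0 hχb hC (by linarith) hν]
    at hn
  have hρ : ‖a‖ = ‖a'‖ :=
    (strictMonoOn_capProfile hks hk1 hkd hχs hχ0 hχm hχb hq0 hq).injOn
      ⟨norm_nonneg a, by linarith⟩ ⟨norm_nonneg a', by linarith⟩ hn
  rcases eq_or_ne a 0 with rfl | ha0
  · rw [norm_zero] at hρ
    rw [norm_eq_zero.1 hρ.symm]
  · have ha0' : a' ≠ 0 := by rw [← norm_ne_zero_iff, ← hρ]; exact norm_ne_zero_iff.2 ha0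
    have h2 := congrArg Prod.snd h
    rw [cap_snd_eq hC ha0, cap_snd_eq hC ha0', ← hρ] at h2
    have hpos := capProfile_pos hkpos hχb hq0 hq (norm_pos_iff.2 ha0) (by linarith : ‖a‖ < 4 / 5)
    have h3 := mul_right_cancel₀ (Complex.ofReal_ne_zero.2 hpos.ne') h2
    have hu : ((‖a‖⁻¹ : ℝ) : ℂ) * a = ((‖a‖⁻¹ : ℝ) : ℂ) * a' := by
      simpa only [Complex.conj_conj] using congrArg conj h3
    refine Prod.ext ?_ rfl
    calc a = ((‖a‖ : ℝ) : ℂ) * (((‖a‖⁻¹ : ℝ) : ℂ) * a) := (unitVec_basic ha0).2.2.1.symm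
      _ = ((‖a'‖ : ℝ) : ℂ) * (((‖a'‖⁻¹ : ℝ) : ℂ) * a') := by rw [hu, hρ]
      _ = a' := (unitVec_basic ha0').2.2.1

include hks hk1 hkpos hkd hχs hχ0 hχ1 hχm hχb hC in
/-- **Cap values stay below far values**: for `‖a′‖ < 2/3 ≤ ‖a‖ < 4/5` and the same fibre
coordinate `ν`, `‖(C (a′, ν)).2‖ < s/(1 - ‖a‖ s)` (the second coordinate of the sheet's tube point
`(a, a ν)` seen in the cap chart): the cap profile is increasing and equals the far profile from
`2/3` on, the far profile is increasing. [folklore] -/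
theorem norm_cap_snd_lt_far {a' a ν : ℂ} (ha' : ‖a'‖ < 2 / 3) (ha : 2 / 3 ≤ ‖a‖) (ha1 : ‖a‖ < 4 / 5)
    (hν : ‖ν‖ < 1 / 2) :
    ‖(C (a', ν)).2‖ < Real.sqrt (1 + ‖ν‖ ^ 2) / (1 - ‖a‖ * Real.sqrt (1 + ‖ν‖ ^ 2)) := by
  have hq0 : 0 ≤ ‖ν‖ ^ 2 := sq_nonneg _
  have hq : ‖ν‖ ^ 2 < 1 / 4 := norm_sq_lt_of_norm_lt hν
  rw [norm_cap_snd hkpos hχ0 hχb hC (by linarith) hν]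
  have hlt := strictMonoOn_capProfile hks hk1 hkd hχs hχ0 hχm hχb hq0 hq ⟨norm_nonneg a', by linarith⟩
    ⟨by norm_num, by norm_num⟩ (ha' : ‖a'‖ < 2 / 3)
  simp only [hχ1 (2 / 3) le_rfl, sub_self, zero_mul, one_mul, zero_add] at hlt
  exact lt_of_lt_of_le hlt (farProfile_le_farProfile ha ha1 hq0 hq)

/-! ### §4 The derivative of the cap map and its invertibility -/

include hk0 hχ0 hC in
/-- Near the centre the cap map `(a, ν) ↦ (ν, conj a)` has the linear left inverse
`(w₁, w₂) ↦ (conj w₂, w₁)`, hence an invertible strict derivative. [folklore] -/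
theorem exists_hasStrictFDerivAt_cap_of_lt {a : ℂ} (ha : ‖a‖ < 1 / 4) (ν : ℂ) :
    ∃ L : (ℂ × ℂ) ≃L[ℝ] (ℂ × ℂ), HasStrictFDerivAt C (L : ℂ × ℂ →L[ℝ] ℂ × ℂ) (a, ν) := by
  refine exists_equiv_of_leftInverse (g := fun w : ℂ × ℂ => (conj w.2, w.1))
    (contDiffAt_cap_of_lt hk0 hχ0 hC ha ν) ?_ ?_
  · exact ((Complex.conjCLE.differentiable.differentiableAt).comp _ differentiableAt_snd).prodMk
      differentiableAt_fst
  · have hmem : {p : ℂ × ℂ | ‖p.1‖ < 1 / 4} ∈ 𝓝 (a, ν) :=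
      (isOpen_lt (continuous_norm.comp continuous_fst) continuous_const).mem_nhds ha
    refine eventually_of_mem hmem ?_
    rintro ⟨b, μ⟩ hb
    show (conj (C (b, μ)).2, (C (b, μ)).1) = (b, μ)
    rw [cap_eq_of_le hk0 hχ0 hC (le_of_lt hb)]
    simp

include hks hk0 hk1 hkpos hkd hχs hχ0 hχm hχb hC in
/-- **Away from the centre the derivative of the cap map is invertible.**  Its first component
is the projection `(δa, δν) ↦ δν` (the first component of `C` is `ν`), and on `(δa, 0)` its
second component is the derivative of `b ↦ conj b̂ • H ‖b‖`, which takes `â ↦ conj â • ∂H/∂ρ`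
(radial curve) and `I a ↦ -I conj â • H` (rotation curve), `∂H/∂ρ > 0`, `H > 0`: so the kernel is
trivial. [folklore] -/
theorem exists_hasStrictFDerivAt_cap_of_ne {a ν : ℂ} (ha0 : a ≠ 0) (ha : ‖a‖ < 3 / 4)
    (hν : ‖ν‖ < 1 / 2) :
    ∃ L : (ℂ × ℂ) ≃L[ℝ] (ℂ × ℂ), HasStrictFDerivAt C (L : ℂ × ℂ →L[ℝ] ℂ × ℂ) (a, ν) := by
  have hq0 : 0 ≤ ‖ν‖ ^ 2 := sq_nonneg _
  have hq : ‖ν‖ ^ 2 < 1 / 4 := norm_sq_lt_of_norm_lt hν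
  have hcd : ContDiffAt ℝ ∞ C (a, ν) := contDiffAt_cap hks hk0 hχs hχ0 hC ha hν
  have hD : HasFDerivAt C (fderiv ℝ C (a, ν)) (a, ν) := (hcd.differentiableAt (by simp)).hasFDerivAt
  set D := fderiv ℝ C (a, ν) with hDdef
  set u : ℂ := ((‖a‖⁻¹ : ℝ) : ℂ) * a with hu
  have hu0 : u ≠ 0 := (unitVec_basic ha0).2.1
  have hcu0 : conj u ≠ 0 := (map_ne_zero (starRingEnd ℂ)).2 hu0
  have hau : a = ((‖a‖ : ℝ) : ℂ) * u := (unitVec_basic ha0).2.2.1.symm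
  -- the cap profile at `q = ‖ν‖²`, its value and derivative at `‖a‖`
  set H : ℝ → ℝ := fun ρ => (1 - χ ρ) * (ρ * k₀ ρ) +
    χ ρ * (Real.sqrt (1 + ‖ν‖ ^ 2) / (1 - ρ * Real.sqrt (1 + ‖ν‖ ^ 2))) with hH
  obtain ⟨d, hd, hHd⟩ := exists_hasDerivAt_capProfile_pos hks hk1 hkd hχs hχ0 hχm hχb hq0 hq
    (norm_pos_iff.2 ha0) (by linarith : ‖a‖ < 4 / 5)
  have hHpos : 0 < H ‖a‖ := capProfile_pos hkpos hχb hq0 hq (norm_pos_iff.2 ha0) (by linarith)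
  -- (1) the first component of `D w` is `w.2`
  have hfst : ∀ w : ℂ × ℂ, (D w).1 = w.2 := by
    have h1 : HasFDerivAt (fun p : ℂ × ℂ => (C p).1) ((ContinuousLinearMap.fst ℝ ℂ ℂ).comp D) (a, ν) :=
      (ContinuousLinearMap.fst ℝ ℂ ℂ).hasFDerivAt.comp (a, ν) hD
    have h2 : HasFDerivAt (fun p : ℂ × ℂ => (C p).1) (ContinuousLinearMap.snd ℝ ℂ ℂ) (a, ν) := by
      have : (fun p : ℂ × ℂ => (C p).1) = Prod.snd := funext fun ⟨b, μ⟩ => cap_fst hC b μ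
      rw [this]; exact hasFDerivAt_snd
    have h12 := h1.unique h2
    intro w
    have := congrArg (fun T : ℂ × ℂ →L[ℝ] ℂ => T w) h12
    simpa using this
  -- (2) the partial map `b ↦ (C (b, ν)).2` and its derivative `E δa = (D (δa, 0)).2`
  have hi : HasFDerivAt (fun b : ℂ => ((b, ν) : ℂ × ℂ)) (ContinuousLinearMap.inl ℝ ℂ ℂ) a :=
    hasFDerivAt_prodMk_left a ν
  have hK : HasFDerivAt (fun b : ℂ => (C (b, ν)).2)
      ((ContinuousLinearMap.snd ℝ ℂ ℂ).comp (D.comp (ContinuousLinearMap.inl ℝ ℂ ℂ))) a :=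
    (ContinuousLinearMap.snd ℝ ℂ ℂ).hasFDerivAt.comp a (hD.comp a hi)
  set E := (ContinuousLinearMap.snd ℝ ℂ ℂ).comp (D.comp (ContinuousLinearMap.inl ℝ ℂ ℂ)) with hE
  have hEapp : ∀ δa : ℂ, E δa = (D (δa, 0)).2 := fun δa => by simp [hE]
  have hid : HasDerivAt (fun s : ℝ => ((s : ℝ) : ℂ)) 1 0 := by
    simpa using (hasDerivAt_id (0 : ℝ)).ofReal_comp
  -- (3a) `E` on the radial direction `û`
  have hEu : E u = conj u * (d : ℂ) := by
    have hc : HasDerivAt (fun s : ℝ => a + (s : ℂ) * u) u 0 := by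
      simpa using (hid.mul_const u).const_add a
    have hchain := hK.comp_hasDerivAt_of_eq (0 : ℝ) hc (by simp)
    have heq : ((fun b : ℂ => (C (b, ν)).2) ∘ fun s : ℝ => a + (s : ℂ) * u) =ᶠ[𝓝 0]
        fun s => conj u * ((H (‖a‖ + s) : ℝ) : ℂ) := by
      have hmem : Ioo (-‖a‖) (3 / 4 - ‖a‖) ∈ 𝓝 (0 : ℝ) := Ioo_mem_nhds (by linarith [norm_pos_iff.2 ha0]) (by linarith)
      refine eventuallyEq_of_mem hmem fun s hs => ?_
      obtain ⟨hs1, hs2⟩ := hs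
      have hts : 0 < ‖a‖ + s := by linarith
      have has : a + (s : ℂ) * u = ((‖a‖ + s : ℝ) : ℂ) * u := by
        conv_lhs => rw [hau]
        push_cast; ring
      have hn : ‖((‖a‖ + s : ℝ) : ℂ) * u‖ = ‖a‖ + s := by
        rw [norm_mul, Complex.norm_real, Real.norm_of_nonneg hts.le, hu, (unitVec_basic ha0).1, mul_one]
      have hne : ((‖a‖ + s : ℝ) : ℂ) * u ≠ 0 := by rw [← norm_ne_zero_iff, hn]; exact hts.ne'
      show (C (a + (s : ℂ) * u, ν)).2 = _
      have hcancel : ∀ {r : ℝ}, r ≠ 0 → ∀ z : ℂ, ((r⁻¹ : ℝ) : ℂ) * ((r : ℂ) * z) = z :=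
        fun hr z => by
          rw [← mul_assoc, ← Complex.ofReal_mul, inv_mul_cancel₀ hr, Complex.ofReal_one, one_mul]
      rw [has, cap_snd_eq hC hne, hn, hu, hcancel hts.ne']
    have hexp : HasDerivAt (fun s : ℝ => conj u * ((H (‖a‖ + s) : ℝ) : ℂ)) (conj u * (d : ℂ)) 0 := by
      have := HasDerivAt.comp_const_add ‖a‖ 0 (by rw [add_zero]; exact hHd)
      exact this.ofReal_comp.const_mul (conj u)
    exact (hchain.congr_of_eventuallyEq heq.symm).unique hexp
  -- (3b) `E` on the rotation direction `I a`
  have hEIa : E (I * a) = -I * (conj u * ((H ‖a‖ : ℝ) : ℂ)) := by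
    have he : HasDerivAt (fun s : ℝ => Complex.exp ((s : ℂ) * I)) I 0 := by
      simpa using (hid.mul_const I).cexp
    have hc : HasDerivAt (fun s : ℝ => Complex.exp ((s : ℂ) * I) * a) (I * a) 0 := he.mul_const a
    have hchain := hK.comp_hasDerivAt_of_eq (0 : ℝ) hc (by simp)
    have heq : ((fun b : ℂ => (C (b, ν)).2) ∘ fun s : ℝ => Complex.exp ((s : ℂ) * I) * a) =
        fun s : ℝ => conj (Complex.exp ((s : ℂ) * I)) * (conj u * ((H ‖a‖ : ℝ) : ℂ)) := by
      funext s
      have hne : Complex.exp ((s : ℂ) * I) * a ≠ 0 := mul_ne_zero (Complex.exp_ne_zero _) ha0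
      show (C (Complex.exp ((s : ℂ) * I) * a, ν)).2 = _
      rw [cap_snd_eq hC hne, (unitVec_rescale ha0 one_pos _).2, norm_mul, Complex.norm_exp_ofReal_mul_I, one_mul, map_mul,
        ← hu, mul_assoc]
    have hconj : HasDerivAt (fun s : ℝ => conj (Complex.exp ((s : ℂ) * I))) (-I) 0 := by
      have := he.star
      simpa using this
    rw [heq] at hchain
    exact hchain.unique (hconj.mul_const _)
  -- (4) the kernel of `D` is trivial
  have hinj : Injective D := by
    rw [injective_iff_map_eq_zero]
    rintro ⟨δa, δν⟩ h0
    have hδν : δν = 0 := by simpa using (hfst (δa, δν)).symm.trans (by rw [h0]; rfl)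
    subst hδν
    have hEδ : E δa = 0 := by rw [hEapp, h0]; rfl
    -- coordinates of `δa` in the real basis `û, I a`
    set P : ℂ := conj u * δa with hP
    have huc : u * conj u = 1 := (unitVec_basic ha0).2.2.2
    have hn0 : ((‖a‖ : ℝ) : ℂ) ≠ 0 := by exact_mod_cast norm_ne_zero_iff.2 ha0
    have hIa : I * a = ((‖a‖ : ℝ) : ℂ) * (I * u) := by rw [mul_left_comm, ← hau]
    have hδa : δa = (P.re : ℂ) * u + ((P.im / ‖a‖ : ℝ) : ℂ) * (I * a) := by
      calc δa = u * P := by rw [hP, ← mul_assoc, huc, one_mul]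
        _ = u * ((P.re : ℂ) + (P.im : ℂ) * I) := by rw [Complex.re_add_im]
        _ = (P.re : ℂ) * u + ((P.im / ‖a‖ : ℝ) : ℂ) * (I * a) := by
          rw [hIa]; push_cast; field_simp
    have hdec : δa = P.re • u + (P.im / ‖a‖) • (I * a) := by
      simpa only [Complex.real_smul] using hδa
    rw [hdec, map_add, map_smul, map_smul, hEu, hEIa, Complex.real_smul, Complex.real_smul] at hEδ
    have hZ : conj u * (((P.re * d : ℝ) : ℂ) + ((-(P.im / ‖a‖ * H ‖a‖) : ℝ) : ℂ) * I) = 0 := by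
      rw [← hEδ]; push_cast; ring
    have hW := (mul_eq_zero.1 hZ).resolve_left hcu0
    have e1 := congrArg Complex.re hW
    have e2 := congrArg Complex.im hW
    simp only [Complex.add_re, Complex.add_im, Complex.ofReal_re, Complex.ofReal_im, Complex.mul_re,
      Complex.mul_im, Complex.I_re, Complex.I_im, Complex.zero_re, Complex.zero_im, mul_zero,
      sub_zero, add_zero, mul_one, zero_add] at e1 e2
    have hPre : P.re = 0 := (mul_eq_zero.1 e1).resolve_right hd.ne'
    have hPim : P.im = 0 := by
      have h1 : P.im / ‖a‖ * H ‖a‖ = 0 := by linarith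
      rcases mul_eq_zero.1 h1 with h | h
      · rcases div_eq_zero_iff.1 h with h' | h'
        · exact h'
        · exact absurd h' (norm_ne_zero_iff.2 ha0)
      · exact absurd h hHpos.ne'
    have hP0 : P = 0 := Complex.ext (by simpa using hPre) (by simpa using hPim)
    have : δa = 0 := by rw [show δa = u * P by rw [hP, ← mul_assoc, huc, one_mul], hP0, mul_zero]
    rw [this]; rfl
  -- (5) conclusion
  have hbij : Bijective D := ⟨hinj, LinearMap.surjective_of_injective (f := D.toLinearMap) hinj⟩
  let L : (ℂ × ℂ) ≃L[ℝ] (ℂ × ℂ) := (LinearEquiv.ofBijective D.toLinearMap hbij).toContinuousLinearEquiv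
  refine ⟨L, ?_⟩
  have hL : (L : ℂ × ℂ →L[ℝ] ℂ × ℂ) = D := ContinuousLinearMap.ext fun x => rfl
  rw [hL, hDdef]
  exact hcd.hasStrictFDerivAt (by simp)

include hks hk0 hk1 hkpos hkd hχs hχ0 hχm hχb hC in
/-- **The cap map has an invertible strict derivative at every point of
`{‖a‖ < 3/4} × {‖ν‖ < 1/2}`.** [folklore] -/
theorem exists_hasStrictFDerivAt_cap {a ν : ℂ} (ha : ‖a‖ < 3 / 4) (hν : ‖ν‖ < 1 / 2) :
    ∃ L : (ℂ × ℂ) ≃L[ℝ] (ℂ × ℂ), HasStrictFDerivAt C (L : ℂ × ℂ →L[ℝ] ℂ × ℂ) (a, ν) := by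
  rcases eq_or_ne a 0 with rfl | ha0
  · exact exists_hasStrictFDerivAt_cap_of_lt hk0 hχ0 hC (by norm_num) ν
  · exact exists_hasStrictFDerivAt_cap_of_ne hks hk0 hk1 hkpos hkd hχs hχ0 hχm hχb hC ha0 ha hν

end Cap

end BlowUpCap

/-! ### §5 The capped proper transform with its tube exists -/

open BlowUpCap in
/-- **The capped proper transform of a coordinate line under blowing up, with its tube, exists.**
There is a map `C : ℂ × ℂ → ℂ × ℂ` (values in the affine chart `[1 : w₁ : w₂] ↦ (w₁, w₂)` of `ℂℙ²`
at `[1 : 0 : 0]`, where the proper transform of the first coordinate line is `{w₁ = 0}`) such that,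
on `U = {‖a‖ < 3/4} × {‖ν‖ < 1/2}`: `C` is `C^∞`; its first component is `ν`; for `‖a‖ ≤ 1/4` it is
the product tube `(ν, conj a)` of the line about the cap centre; for `2/3 ≤ ‖a‖` it is
`(ν, conj â • s/(1 - ‖a‖ s))`, `s = √(1 + ‖ν‖²)` — the Kervaire–Milnor image
`(a, a ν) = t • u ∼ (1 - t) • u` of the product tube of the sheet `{(a, 0)}` with the framing
turned once positively (`a ν = ‖a‖ â ν`); its core on `1/2 ≤ ‖a‖ < 1` is
`(0, conj â/(1 - ‖a‖))`, the sheet itself seen in `ℂℙ²`; it is injective on `U` with an invertible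
strict derivative at every point; and the norm of its second component at `‖a′‖ < 2/3` stays below
the value `s/(1 - ‖a‖ s)` of the sheet's tube at any `2/3 ≤ ‖a‖ < 4/5` with the same `ν`.
(Blowing up a point is the connected sum with `ℂℙ²bar`, and the proper transforms of the two
coordinate lines `{z₁ z₂ = 0}` are disjoint lines: McDuff–Salamon, Exercise 7.1.4 (ii) and
Example 7.1.9; used for `Σ̄₂ ⊂ T⁴ # ℂℙ²bar`, Akhmedov–Park 2010 §3.)
[cite: McDuffSalamon2017, Exercise 7.1.4 (ii) and Example 7.1.9] [cite: KervaireMilnor1963, §2]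
[cite: AkhmedovPark2010, §3] -/
theorem exists_blowUpCapTube : ∃ C : ℂ × ℂ → ℂ × ℂ,
    ContDiffOn ℝ ∞ C {p : ℂ × ℂ | ‖p.1‖ < 3 / 4 ∧ ‖p.2‖ < 1 / 2} ∧
    (∀ a ν : ℂ, (C (a, ν)).1 = ν) ∧
    (∀ a ν : ℂ, ‖a‖ ≤ 1 / 4 → C (a, ν) = (ν, conj a)) ∧
    (∀ a ν : ℂ, 2 / 3 ≤ ‖a‖ → C (a, ν) = (ν, conj (((‖a‖⁻¹ : ℝ) : ℂ) * a) *
      (Real.sqrt (1 + ‖ν‖ ^ 2) / (1 - ‖a‖ * Real.sqrt (1 + ‖ν‖ ^ 2)) : ℝ))) ∧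
    (∀ a : ℂ, 1 / 2 ≤ ‖a‖ → ‖a‖ < 1 →
      C (a, 0) = (0, conj (((‖a‖⁻¹ : ℝ) : ℂ) * a) * (((1 - ‖a‖)⁻¹ : ℝ) : ℂ))) ∧
    InjOn C {p : ℂ × ℂ | ‖p.1‖ < 3 / 4 ∧ ‖p.2‖ < 1 / 2} ∧
    (∀ p : ℂ × ℂ, ‖p.1‖ < 3 / 4 → ‖p.2‖ < 1 / 2 →
      ∃ L : (ℂ × ℂ) ≃L[ℝ] (ℂ × ℂ), HasStrictFDerivAt C (L : ℂ × ℂ →L[ℝ] ℂ × ℂ) p) ∧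
    (∀ a' a ν : ℂ, ‖a'‖ < 2 / 3 → 2 / 3 ≤ ‖a‖ → ‖a‖ < 4 / 5 → ‖ν‖ < 1 / 2 →
      ‖(C (a', ν)).2‖ < Real.sqrt (1 + ‖ν‖ ^ 2) / (1 - ‖a‖ * Real.sqrt (1 + ‖ν‖ ^ 2))) := by
  -- the stretch `k₀ = G/ρ` and the step `χ`, `S` the smooth transition
  let S : ℝ → ℝ := Real.smoothTransition
  let k₀ : ℝ → ℝ := fun ρ => (1 - S (4 * ρ - 1)) + S (4 * ρ - 1) * (ρ * (1 - ρ))⁻¹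
  let χ : ℝ → ℝ := fun ρ => S (6 * ρ - 3)
  have hSs : ContDiff ℝ ∞ S := Real.smoothTransition.contDiff
  have hS4 : ContDiff ℝ ∞ fun ρ : ℝ => S (4 * ρ - 1) :=
    hSs.comp ((contDiff_const.mul contDiff_id).sub contDiff_const)
  have hk0 : ∀ ρ, ρ ≤ 1 / 4 → k₀ ρ = 1 := fun ρ hρ => by
    show (1 - S (4 * ρ - 1)) + S (4 * ρ - 1) * (ρ * (1 - ρ))⁻¹ = 1
    rw [show S (4 * ρ - 1) = 0 from Real.smoothTransition.zero_of_nonpos (by linarith)]; ring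
  have hk1 : ∀ ρ, 1 / 2 ≤ ρ → ρ < 1 → k₀ ρ = (ρ * (1 - ρ))⁻¹ := fun ρ hρ _ => by
    show (1 - S (4 * ρ - 1)) + S (4 * ρ - 1) * (ρ * (1 - ρ))⁻¹ = (ρ * (1 - ρ))⁻¹
    rw [show S (4 * ρ - 1) = 1 from Real.smoothTransition.one_of_one_le (by linarith)]; ring
  have hks : ∀ ρ, ρ < 1 → ContDiffAt ℝ ∞ k₀ ρ := fun ρ hρ => by
    rcases lt_or_ge ρ (1 / 4) with h | h
    · have : k₀ =ᶠ[𝓝 ρ] fun _ => 1 := eventuallyEq_of_mem (Iio_mem_nhds h) fun r hr => hk0 r (le_of_lt hr)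
      exact contDiffAt_const.congr_of_eventuallyEq this
    · have hne : ρ * (1 - ρ) ≠ 0 := mul_ne_zero (by linarith) (by linarith)
      exact (contDiffAt_const.sub hS4.contDiffAt).add
        (hS4.contDiffAt.mul ((contDiffAt_id.mul (contDiffAt_const.sub contDiffAt_id)).inv hne))
  have hkpos : ∀ ρ, 0 ≤ ρ → ρ < 1 → 0 < k₀ ρ := fun ρ hρ0 hρ1 => by
    rcases le_or_gt ρ (1 / 4) with h | h
    · rw [hk0 ρ h]; exact one_pos
    · show 0 < (1 - S (4 * ρ - 1)) + S (4 * ρ - 1) * (ρ * (1 - ρ))⁻¹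
      have hx : 0 < (ρ * (1 - ρ))⁻¹ := inv_pos.2 (mul_pos (by linarith) (by linarith))
      have h0 := Real.smoothTransition.nonneg (4 * ρ - 1)
      have h1 := Real.smoothTransition.le_one (4 * ρ - 1)
      rcases lt_or_ge (S (4 * ρ - 1)) 1 with h' | h'
      · nlinarith
      · have : S (4 * ρ - 1) = 1 := le_antisymm h1 h'
        rw [this]; linarith
  have hkd : ∀ ρ, 0 < ρ → ρ < 1 → 0 < deriv (fun r => r * k₀ r) ρ := fun ρ hρ0 hρ1 => by
    -- on `(0, 1)` the stretch is `g r = (1 - S(4r-1)) r + S(4r-1)/(1 - r)`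
    have heq : (fun r => r * k₀ r) =ᶠ[𝓝 ρ] fun r => (1 - S (4 * r - 1)) * r + S (4 * r - 1) * (1 - r)⁻¹ := by
      refine eventuallyEq_of_mem (Ioo_mem_nhds hρ0 hρ1) fun r hr => ?_
      obtain ⟨hr0, hr1⟩ := hr
      show r * ((1 - S (4 * r - 1)) + S (4 * r - 1) * (r * (1 - r))⁻¹) = _
      have : r ≠ 0 := hr0.ne'
      have : 1 - r ≠ 0 := by linarith
      field_simp
    rw [heq.deriv_eq]
    have hSd : HasDerivAt (fun r => S (4 * r - 1)) (deriv S (4 * ρ - 1) * 4) ρ := by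
      have h1 : HasDerivAt (fun r : ℝ => 4 * r - 1) 4 ρ := by
        simpa using ((hasDerivAt_id ρ).const_mul (4 : ℝ)).sub_const 1
      exact ((hSs.differentiable (by simp)) _).hasDerivAt.comp ρ h1
    have hinv : HasDerivAt (fun r : ℝ => (1 - r)⁻¹) ((1 - ρ) ^ 2)⁻¹ ρ := by
      have h1 : HasDerivAt (fun r : ℝ => 1 - r) (-1) ρ := by simpa using (hasDerivAt_id ρ).const_sub 1
      exact (h1.inv (by linarith)).congr_deriv (by field_simp)
    have hg : HasDerivAt (fun r => (1 - S (4 * r - 1)) * r + S (4 * r - 1) * (1 - r)⁻¹)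
        ((-(deriv S (4 * ρ - 1) * 4)) * ρ + (1 - S (4 * ρ - 1)) * 1 +
          (deriv S (4 * ρ - 1) * 4 * (1 - ρ)⁻¹ + S (4 * ρ - 1) * ((1 - ρ) ^ 2)⁻¹)) ρ :=
      ((hSd.const_sub 1).mul (hasDerivAt_id ρ)).add (hSd.mul hinv)
    rw [hg.deriv]
    have hS' : 0 ≤ deriv S (4 * ρ - 1) := Real.smoothTransition.monotone.deriv_nonneg
    have h0 := Real.smoothTransition.nonneg (4 * ρ - 1)
    have h1 := Real.smoothTransition.le_one (4 * ρ - 1)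
    have hinv1 : 1 ≤ (1 - ρ)⁻¹ := one_le_inv₀ (by linarith) |>.2 (by linarith)
    have hinv2 : 1 ≤ ((1 - ρ) ^ 2)⁻¹ := one_le_inv₀ (by positivity) |>.2 (by nlinarith)
    nlinarith [mul_nonneg hS' (by linarith : (0 : ℝ) ≤ (1 - ρ)⁻¹ - ρ)]
  have hχs : ContDiff ℝ ∞ χ := hSs.comp ((contDiff_const.mul contDiff_id).sub contDiff_const)
  have hχ0 : ∀ ρ, ρ ≤ 1 / 2 → χ ρ = 0 := fun ρ hρ => Real.smoothTransition.zero_of_nonpos (by linarith)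
  have hχ1 : ∀ ρ, 2 / 3 ≤ ρ → χ ρ = 1 := fun ρ hρ => Real.smoothTransition.one_of_one_le (by linarith)
  have hχm : Monotone χ := Real.smoothTransition.monotone.comp fun x y hxy => by linarith
  have hχb : ∀ ρ, 0 ≤ χ ρ ∧ χ ρ ≤ 1 := fun ρ =>
    ⟨Real.smoothTransition.nonneg _, Real.smoothTransition.le_one _⟩
  -- the cap map
  let C : ℂ × ℂ → ℂ × ℂ := fun p => (p.2, conj p.1 *
    (((1 - χ ‖p.1‖) * k₀ ‖p.1‖ + χ ‖p.1‖ *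
      (Real.sqrt (1 + ‖p.2‖ ^ 2) / (1 - ‖p.1‖ * Real.sqrt (1 + ‖p.2‖ ^ 2)) / ‖p.1‖) : ℝ) : ℂ))
  have hC : ∀ a ν, C (a, ν) = (ν, conj a *
      (((1 - χ ‖a‖) * k₀ ‖a‖ + χ ‖a‖ *
        (Real.sqrt (1 + ‖ν‖ ^ 2) / (1 - ‖a‖ * Real.sqrt (1 + ‖ν‖ ^ 2)) / ‖a‖) : ℝ) : ℂ)) := fun a ν => rfl
  refine ⟨C, fun p hp => (contDiffAt_cap hks hk0 hχs hχ0 hC (a := p.1) (ν := p.2) hp.1 hp.2).contDiffWithinAt,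
    cap_fst hC, fun a ν ha => cap_eq_of_le hk0 hχ0 hC ha ν, fun a ν ha => cap_eq_of_ge hχ1 hC ha ν,
    fun a ha ha1 => cap_core_of_ge hk1 hC ha ha1,
    injOn_cap hks hk1 hkpos hkd hχs hχ0 hχm hχb hC,
    fun p hp1 hp2 => exists_hasStrictFDerivAt_cap hks hk0 hk1 hkpos hkd hχs hχ0 hχm hχb hC (a := p.1) (ν := p.2) hp1 hp2,
    fun a' a ν ha' ha ha1 hν => norm_cap_snd_lt_far hks hk1 hkpos hkd hχs hχ0 hχ1 hχm hχb hC ha' ha ha1 hν⟩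

end Literature.Topology.FourManifolds
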